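import Literature.RingTheory.MvPolynomial.KaltofenTestMatrixProofs
import Literature.NumberTheory.DiophantineGeometry.BertiniLocalIrreducibilityProofs
import Literature.NumberTheory.DiophantineGeometry.BertiniResultantProofs
import Literature.NumberTheory.DiophantineGeometry.BertiniMinorProofs
import Mathlib.LinearAlgebra.Lagrange
import Mathlib.FieldTheory.IsAlgClosed.AlgebraicClosure
import HarnessLib

/-!
# Kaltofen's Theorem 4, correctness half: the forms `Δ_S` detect absolute reducibility

E. Kaltofen, *Effective Noether irreducibility forms and applications*, J. Comput. System Sci.
50 (1995) 274–295 [`Kaltofen1995`], §2 (Algorithm Absolute Irreducibility Test and its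
correctness, Lemma 2 = Kaltofen 1985 Thm. 3) and §3 Thm. 4 ("`f` is absolutely irreducible if and
only if not all `Δ(…, c_{e₁,e₂}, …) = 0`"), for the division-free objects of `KaltofenTestDefs`
(namespace `KaltofenAIT`):

* `genMinor_correct_of_isAlgClosed`: over an algebraically closed field `K`, for `Q ∈ K[y][x]`
  monic of degree `d ≥ 2` in `x`, of total degree `≤ d`, with `Res_x(Q(x,0), ∂ₓQ(x,0)) ≠ 0`,
  all the integer forms `genMinor d S` vanish at the coefficients of `Q` iff `Q` is reducible;
* `genMinor_correct`: the same over any field `F`, with reducibility over `F̄`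
  (the shape of the hypothesis of `kaltofen1995_thm7_of_genMinor_correct`).

Proof (Kaltofen §2–3, in the organisation of the tree): the generic matrix (29) specialises to
the matrix of `Q` (`kMatrix_mapP`, `mapP_specialize_genPoly`); all maximal minors vanish iff the
columns are dependent iff some `w ≠ 0` solves (29) (`exists_det_submatrix_ne_zero` of
`BertiniMinorProofs`); by `kMatrix_mulVec_eq_zero_iff` this means a nonzero small
`h ∈ R[y][x]` (`R = K[z]/(Q(z,0))`, a product of copies of `K` since `Q(z,0)` is separable) with
`h(α) ≡ 0 mod y^{ℓ+1}` on Kaltofen's approximate root `α`; evaluating `R → K` at the roots `ζ`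
of `Q(z,0)` (`evRoot`) turns this into small annihilators of the power-series branches of `Q` at
the simple points `(ζ, 0)`, which exist iff `Q` is reducible: "⇒" by the resultant argument
`eq_zero_of_pow_dvd_eval` (`BertiniResultantProofs`, precision `ℓ + 1 = (2d−1)d + 1`), "⇐" by
`irreducible_of_noSmallAnnihilator` (`BertiniLocalIrreducibilityProofs`, root precision
`2(ℓ+1)` = Kaltofen's `K' + 1`) at one root together with a Lagrange idempotent of `R`.

No definitions, no named facts.

## References

* E. Kaltofen, J. Comput. System Sci. 50 (1995) 274–295, §2 (Lemma 2, correctness of the test),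
  §3 Thm. 4. [Kaltofen1995]
* E. Kaltofen, *Fast parallel absolute irreducibility testing*, J. Symbolic Comput. 1 (1985)
  57–67, Thm. 3 (cited through [Kaltofen1995]).
-/

noncomputable section

open Polynomial

universe u

namespace Literature.RingTheory.MvPolynomial.KaltofenFormsCorrect

open Literature.RingTheory.MvPolynomial.KaltofenAIT
open Literature.NumberTheory.DiophantineGeometry

/-! ### The generic polynomial specialises to every admissible polynomial -/

section Specialize

variable {A : Type u} [CommRing A] {d : ℕ}

/-- The coefficient of `x^m yʲ` in `genPoly d`: `1` at `(d, 0)`, the variable `c_{m,j}` on the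
generic support, `0` elsewhere (local copy of `KaltofenBounds.coeff_coeff_genPoly` of the bounds
file, repeated here so that this correctness file does not depend on the bounds). [folklore] -/
private theorem coeff_coeff_genPoly (d m j : ℕ) :
    ((genPoly d).coeff m).coeff j =
      (if m = d ∧ j = 0 then 1 else 0) + (if (m, j) ∈ genSupport d then MvPolynomial.X (m, j) else 0) := by
  classical
  rw [genPoly, coeff_add, coeff_X_pow, finsetSum_coeff, coeff_add]
  congr 1
  · split_ifs with h1 h2 h2
    · rw [coeff_one, if_pos h2.2]
    · rw [coeff_one, if_neg]; intro hj; exact h2 ⟨h1, hj⟩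
    · exact absurd h2.1 h1
    · rw [coeff_zero]
  · rw [finsetSum_coeff]
    have : ∀ p ∈ genSupport d, ((C (C (MvPolynomial.X p) * X ^ p.2) * X ^ p.1 :
        Polynomial (Polynomial GenCoeff)).coeff m).coeff j = if (m, j) = p then MvPolynomial.X p else 0 := by
      intro p _
      rw [coeff_C_mul_X_pow]
      split_ifs with h1 h2 h2
      · rw [coeff_C_mul_X_pow, if_pos]; rw [← h2]
      · rw [coeff_C_mul_X_pow, if_neg]; intro hj; exact h2 (Prod.ext h1 hj)
      · exact absurd (congrArg Prod.fst h2) h1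
      · rw [coeff_zero]
    rw [Finset.sum_congr rfl this, Finset.sum_ite_eq]

/-- A monic `Q ∈ A[y][x]` of `x`-degree `d` and total degree `≤ d` is the specialisation of the
generic polynomial at its coefficient vector. [cite: Kaltofen1995, §3 (generic f), Thm. 7] -/
theorem mapP_specialize_genPoly (Q : Polynomial A[X]) (hmo : Q.Monic) (hdeg : Q.natDegree = d)
    (htot : ∀ i j, d < i + j → (Q.coeff i).coeff j = 0) :
    mapP (specialize (coeffVec Q)) (genPoly d) = Q := by
  ext n j
  rw [mapP, coeff_map, coe_mapRingHom, coeff_map, coeff_coeff_genPoly, map_add]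
  have hspecX : ∀ p : ℕ × ℕ, specialize (coeffVec Q) (MvPolynomial.X p) = (Q.coeff p.1).coeff p.2 := fun p => by
    simp [specialize, coeffVec]
  by_cases hnd : n = d
  · rw [hnd]
    have hlead : Q.coeff d = 1 := by rw [← hdeg]; exact hmo
    have hnot : (d, j) ∉ genSupport d := fun h => absurd (mem_genSupport.1 h).1 (lt_irrefl _)
    rw [if_neg hnot, map_zero, add_zero, hlead, coeff_one]
    by_cases hj : j = 0
    · rw [if_pos ⟨rfl, hj⟩, map_one, if_pos hj]
    · rw [if_neg (fun h => hj h.2), map_zero, if_neg hj]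
  · rw [if_neg (fun h => hnd h.1), map_zero, zero_add]
    by_cases hmem : (n, j) ∈ genSupport d
    · rw [if_pos hmem, hspecX]
    · rw [if_neg hmem, map_zero]
      simp only [mem_genSupport, not_and_or, not_lt, not_le] at hmem
      rcases hmem with h | h
      · have hlt : d < n := lt_of_le_of_ne h (Ne.symm hnd)
        rw [show Q.coeff n = 0 from coeff_eq_zero_of_natDegree_lt (by rw [hdeg]; exact hlt), coeff_zero]
      · exact (htot n j h).symm

/-- `kMatrix` does not depend on the presentation of its polynomial argument. [folklore] -/
theorem kMatrix_congr {P P' : Polynomial A[X]} (h : P = P') {d e K ℓ : ℕ} (hm : (red P).Monic)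
    (hm' : (red P').Monic) : (kMatrix P' d e K hm' ℓ).submatrix id id = kMatrix P' d e K hm' ℓ ∧
      HEq (kMatrix P d e K hm ℓ) (kMatrix P' d e K hm' ℓ) := by
  subst h; exact ⟨rfl, HEq.rfl⟩

/-- **The forms `Δ_S` specialise to the maximal minors of the matrix (29) of `Q`.**
[cite: Kaltofen1995, §3 Thm. 4, §5 proof of Thm. 7] -/
theorem specialize_genMinor (Q : Polynomial A[X]) (hmo : Q.Monic) (hdeg : Q.natDegree = d)
    (htot : ∀ i j, d < i + j → (Q.coeff i).coeff j = 0) (hm : (red Q).Monic)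
    (S : Fin d × Fin (d + 1) × Fin d → Fin ((2 * d - 1) * d + 1) × Fin d) :
    specialize (coeffVec Q) (genMinor d S) =
      ((kMatrix Q d d (2 * ((2 * d - 1) * d) + 1) hm ((2 * d - 1) * d)).submatrix S id).det := by
  have hP := mapP_specialize_genPoly Q hmo hdeg htot
  have hm' : (red (mapP (specialize (coeffVec Q)) (genPoly d))).Monic := by rw [hP]; exact hm
  have hmat : kMatrix (mapP (specialize (coeffVec Q)) (genPoly d)) d d (2 * ((2 * d - 1) * d) + 1) hm'
      ((2 * d - 1) * d) = kMatrix Q d d (2 * ((2 * d - 1) * d) + 1) hm ((2 * d - 1) * d) :=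
    eq_of_heq (kMatrix_congr hP hm' hm).2
  rw [genMinor, RingHom.map_det, RingHom.mapMatrix_apply, ← Matrix.submatrix_map, ← kMatrix_mapP _ _ _ _ _ _ hm',
    hmat]

end Specialize

/-! ### Maximal minors and the kernel -/

section Minors

variable {K : Type u} [Field K] {m : Type*} [Fintype m] {n : Type*} [Fintype n] [DecidableEq n]

/-- Over a field: all maximal minors of `M` (rows chosen by arbitrary maps `n → m`) vanish iff the
columns are dependent, i.e. iff `M w = 0` has a nonzero solution. [folklore] -/
theorem forall_det_submatrix_eq_zero_iff (M : Matrix m n K) :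
    (∀ S : n → m, (M.submatrix S id).det = 0) ↔ ∃ w : n → K, w ≠ 0 ∧ M.mulVec w = 0 := by
  constructor
  · intro h
    by_contra hne
    push Not at hne
    have hinj : Function.Injective M.mulVec := by
      intro v w hvw
      have : M.mulVec (v - w) = 0 := by rw [Matrix.mulVec_sub, hvw, sub_self]
      by_contra hvw'
      exact hne (v - w) (sub_ne_zero.2 hvw') this
    obtain ⟨f, -, hf⟩ := exists_det_submatrix_ne_zero M (Matrix.mulVec_injective_iff.1 hinj)
    exact hf (by convert h f)
  · rintro ⟨w, hw, hMw⟩ S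
    refine (Matrix.exists_mulVec_eq_zero_iff).1 ⟨w, hw, ?_⟩
    ext c
    have := congr_fun hMw (S c)
    simpa [Matrix.mulVec, dotProduct, Matrix.submatrix_apply] using this

end Minors

/-! ### `R = K[z]/(Q(z,0))` at the roots of `Q(z,0)` -/

section Roots

variable {K : Type u} [Field K] (Q : Polynomial K[X]) {d : ℕ}

/-- `Res(Q₀, Q₀') ≠ 0` makes `Q₀ = Q(x,0)` separable. [cite: Kaltofen1995, §2 ("we must enforce two
input conditions")] -/
theorem separable_red (hdeg : (red Q).natDegree = d) (hd : d ≠ 0) (hρ : rres Q d ≠ 0) : (red Q).Separable := by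
  obtain ⟨p, q, -, -, hpq⟩ := exists_mul_add_mul_eq_C_resultant (red Q) (derivative (red Q)) (m := d) (n := d - 1)
    hdeg.le ((natDegree_derivative_le _).trans (by omega)) (Or.inl hd)
  rw [separable_def]
  refine ⟨C (rres Q d)⁻¹ * p, C (rres Q d)⁻¹ * q, ?_⟩
  rw [rres] at hρ ⊢
  calc C (resultant (red Q) (derivative (red Q)) d (d - 1))⁻¹ * p * red Q +
        C (resultant (red Q) (derivative (red Q)) d (d - 1))⁻¹ * q * derivative (red Q)
      = C (resultant (red Q) (derivative (red Q)) d (d - 1))⁻¹ *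
          (red Q * p + derivative (red Q) * q) := by ring
    _ = 1 := by rw [hpq, ← C_mul, inv_mul_cancel₀ hρ, C_1]

/-- The evaluations at the roots: `evRoot ζ (p(z̄)) = p(ζ)`. [folklore] -/
theorem evRoot_mk (ζ : (red Q).rootSet K) (p : K[X]) : evRoot Q ζ (AdjoinRoot.mk (red Q) p) = p.eval (ζ : K) := by
  rw [AdjoinRoot.lift_mk, Algebra.algebraMap_self, eval₂_eq_eval_map, Polynomial.map_id]

/-- `evRoot ζ` is the identity on the constants. [folklore] -/
theorem evRoot_comp_algebraMap (ζ : (red Q).rootSet K) : (evRoot Q ζ).comp (algebraMap K (Rt Q)) = RingHom.id K := by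
  ext a
  rw [RingHom.comp_apply, AdjoinRoot.algebraMap_eq, RingHom.id_apply, AdjoinRoot.lift_of, Algebra.algebraMap_self,
    RingHom.id_apply]

/-- `Q` read in `R[y][x]` and mapped to a root is `Q` again. [folklore] -/
theorem liftR_map_evRoot (ζ : (red Q).rootSet K) : (liftR Q).map (mapRingHom (evRoot Q ζ)) = Q := by
  rw [Polynomial.map_map, mapRingHom_comp, evRoot_comp_algebraMap, mapRingHom_id, Polynomial.map_id]

/-- Evaluation of a bivariate object over `R` at a root commutes with substitution of the
approximate root. [folklore] -/
theorem map_eval_eq {R S : Type*} [CommRing R] [CommRing S] (f : R →+* S) (h : Polynomial R[X]) (a : R[X]) :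
    (h.eval a).map f = (h.map (mapRingHom f)).eval (a.map f) := by
  induction h using Polynomial.induction_on' with
  | add p q hp hq => rw [eval_add, Polynomial.map_add, hp, hq, Polynomial.map_add, eval_add]
  | monomial n c =>
    rw [eval_monomial, Polynomial.map_mul, Polynomial.map_pow, Polynomial.map_monomial, eval_monomial, coe_mapRingHom]

/-- A Lagrange idempotent: an element of `R` which is `1` at the root `ζ₁` and `0` at the others.
[folklore] -/
theorem exists_idempotent (ζ₁ : (red Q).rootSet K) :
    ∃ L : K[X], L.natDegree < Fintype.card ((red Q).rootSet K) ∧ L ≠ 0 ∧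
      evRoot Q ζ₁ (AdjoinRoot.mk (red Q) L) = 1 ∧
      ∀ ζ : (red Q).rootSet K, ζ ≠ ζ₁ → evRoot Q ζ (AdjoinRoot.mk (red Q) L) = 0 := by
  classical
  have hinj : Set.InjOn (fun ζ : (red Q).rootSet K => (ζ : K)) ↑(Finset.univ : Finset ((red Q).rootSet K)) :=
    fun a _ b _ h => Subtype.ext h
  refine ⟨Lagrange.basis Finset.univ (fun ζ : (red Q).rootSet K => (ζ : K)) ζ₁, ?_, ?_, ?_, fun ζ hζ => ?_⟩
  · rw [Lagrange.natDegree_basis hinj (Finset.mem_univ _), Finset.card_univ]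
    exact Nat.sub_lt (Fintype.card_pos_iff.2 ⟨ζ₁⟩) (by norm_num)
  · exact Lagrange.basis_ne_zero hinj (Finset.mem_univ _)
  · rw [evRoot_mk]; exact Lagrange.eval_basis_self hinj (Finset.mem_univ _)
  · rw [evRoot_mk]; exact Lagrange.eval_basis_of_ne (Ne.symm hζ) (Finset.mem_univ _)

variable [IsAlgClosed K]

/-- The number of roots of the separable `Q₀` is its degree. [folklore] -/
theorem card_rootSet_red (hdeg : (red Q).natDegree = d) (hsep : (red Q).Separable) :
    Fintype.card ((red Q).rootSet K) = d :=
  (card_rootSet_eq_natDegree hsep (IsAlgClosed.splits _)).trans hdeg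

/-- **`R = K[z]/(Q₀)` embeds into `∏_ζ K`:** an element vanishing at every root of the separable
`Q₀` is zero. [folklore] -/
theorem eq_zero_of_forall_evRoot (hm : (red Q).Monic) (hdeg : (red Q).natDegree = d) (hd : d ≠ 0)
    (hsep : (red Q).Separable) (u : Rt Q) (h : ∀ ζ : (red Q).rootSet K, evRoot Q ζ u = 0) : u = 0 := by
  have hu := AdjoinRoot.mk_leftInverse hm u
  set p := AdjoinRoot.modByMonicHom hm u with hp
  have hpdeg : p.natDegree < d := by
    obtain ⟨g, rfl⟩ := AdjoinRoot.mk_surjective u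
    rw [hp, AdjoinRoot.modByMonicHom_mk, ← hdeg]
    exact natDegree_modByMonic_lt g hm (fun h1 => hd (by rw [← hdeg, h1, natDegree_one]))
  have hp0 : p = 0 := by
    refine eq_zero_of_natDegree_lt_card_of_eval_eq_zero p
      (f := fun ζ : (red Q).rootSet K => (ζ : K)) Subtype.val_injective (fun ζ => ?_) ?_
    · have := h ζ
      rwa [← hu, evRoot_mk] at this
    · rwa [card_rootSet_red Q hdeg hsep]
  rw [← hu, hp0, map_zero]

/-- Divisibility by `y^n` in `R[y]` may be checked at every root. [folklore] -/
theorem X_pow_dvd_of_forall_evRoot (hm : (red Q).Monic) (hdeg : (red Q).natDegree = d) (hd : d ≠ 0)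
    (hsep : (red Q).Separable) (q : (Rt Q)[X]) (n : ℕ)
    (h : ∀ ζ : (red Q).rootSet K, (X : K[X]) ^ n ∣ q.map (evRoot Q ζ)) : (X : (Rt Q)[X]) ^ n ∣ q := by
  rw [X_pow_dvd_iff]
  intro k hk
  refine eq_zero_of_forall_evRoot Q hm hdeg hd hsep _ fun ζ => ?_
  have := (X_pow_dvd_iff.1 (h ζ)) k hk
  rwa [coeff_map] at this

end Roots

/-! ### The candidate factors `h_w` -/

section SmallPoly

variable {K : Type u} [Field K] (Q : Polynomial K[X]) (d e : ℕ)

/-- `h_w` has `x`-degree `< d`. [folklore] -/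
theorem natDegree_smallPoly_le (w : Fin d × Fin (e + 1) × Fin d → K) : (smallPoly Q d e w).natDegree ≤ d - 1 := by
  rw [smallPoly]
  refine natDegree_sum_le_of_forall_le _ _ fun c _ => ?_
  refine (natDegree_C_mul_X_pow_le _ _).trans ?_
  have := c.1.is_lt; omega

/-- The coefficients of `h_w` have `y`-degree `≤ e`. [folklore] -/
theorem natDegree_coeff_smallPoly_le (w : Fin d × Fin (e + 1) × Fin d → K) (i : ℕ) :
    ((smallPoly Q d e w).coeff i).natDegree ≤ e := by
  rw [smallPoly, finsetSum_coeff]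
  refine natDegree_sum_le_of_forall_le _ _ fun c _ => ?_
  rw [coeff_C_mul_X_pow]
  split_ifs
  · refine (natDegree_C_mul_X_pow_le _ _).trans ?_
    have := c.2.1.is_lt; omega
  · rw [natDegree_zero]; exact Nat.zero_le _

/-- The `(xⁱ yˡ)`-coefficient of `h_w` is `Σ_ι w_{i,l,ι} z̄^ι`. [folklore] -/
theorem coeff_coeff_smallPoly (w : Fin d × Fin (e + 1) × Fin d → K) (i : Fin d) (l : Fin (e + 1)) :
    ((smallPoly Q d e w).coeff i).coeff l =
      AdjoinRoot.mk (red Q) (∑ ι : Fin d, C (w (i, l, ι)) * X ^ (ι : ℕ)) := by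
  classical
  rw [smallPoly, finsetSum_coeff, finsetSum_coeff, map_sum]
  have : ∀ c : Fin d × Fin (e + 1) × Fin d,
      ((C (C (algebraMap K (Rt Q) (w c) * zbar Q ^ (c.2.2 : ℕ)) * X ^ (c.2.1 : ℕ)) * X ^ (c.1 : ℕ) :
        Polynomial (Rt Q)[X]).coeff i).coeff l =
        if c.1 = i ∧ c.2.1 = l then algebraMap K (Rt Q) (w c) * zbar Q ^ (c.2.2 : ℕ) else 0 := by
    intro c
    rw [coeff_C_mul_X_pow]
    split_ifs with h1 h2 h2
    · rw [coeff_C_mul_X_pow, if_pos (show (l : ℕ) = c.2.1 by rw [h2.2])]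
    · rw [coeff_C_mul_X_pow, if_neg]
      intro hl; exact h2 ⟨(Fin.ext h1).symm, (Fin.ext hl).symm⟩
    · exact absurd (congrArg Fin.val h2.1).symm h1
    · rw [coeff_zero]
  simp_rw [this]
  rw [Finset.sum_ite, Finset.sum_const_zero, add_zero]
  have hfil : (Finset.univ.filter fun c : Fin d × Fin (e + 1) × Fin d => c.1 = i ∧ c.2.1 = l) =
      (Finset.univ : Finset (Fin d)).image fun ι => (i, l, ι) := by
    ext ⟨a, b, c⟩
    simp only [Finset.mem_filter, Finset.mem_univ, true_and, Finset.mem_image, Prod.mk.injEq]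
    constructor
    · rintro ⟨rfl, rfl⟩; exact ⟨c, rfl, rfl, rfl⟩
    · rintro ⟨ι, rfl, rfl, rfl⟩; exact ⟨rfl, rfl⟩
  rw [hfil, Finset.sum_image (fun a _ b _ h => by simpa using h)]
  refine Finset.sum_congr rfl fun ι _ => ?_
  rw [map_mul, map_pow, AdjoinRoot.mk_C, AdjoinRoot.mk_X, AdjoinRoot.algebraMap_eq]

/-- A nonzero vector of unknowns gives a nonzero candidate factor at some root: if `w ≠ 0` then
some coefficient of `h_w` is nonzero at some root `ζ`. [folklore] -/
theorem exists_evRoot_coeff_ne_zero [IsAlgClosed K] (hm : (red Q).Monic) (hdeg : (red Q).natDegree = d)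
    (hd : d ≠ 0) (hsep : (red Q).Separable) (w : Fin d × Fin (e + 1) × Fin d → K) (hw : w ≠ 0) :
    ∃ (ζ : (red Q).rootSet K) (i : Fin d) (l : Fin (e + 1)),
      evRoot Q ζ (((smallPoly Q d e w).coeff i).coeff l) ≠ 0 := by
  obtain ⟨⟨i, l, ι⟩, hc⟩ : ∃ c, w c ≠ 0 := by
    by_contra h; push Not at h; exact hw (funext h)
  have hne : ((smallPoly Q d e w).coeff i).coeff l ≠ 0 := by
    rw [coeff_coeff_smallPoly, Ne, AdjoinRoot.mk_eq_zero]
    intro hdvd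
    have hp0 : (∑ ι : Fin d, C (w (i, l, ι)) * X ^ (ι : ℕ) : K[X]) ≠ 0 := by
      intro h0
      have := congrArg (fun p : K[X] => p.coeff ι) h0
      simp only [finsetSum_coeff, coeff_C_mul_X_pow, coeff_zero] at this
      rw [Finset.sum_eq_single ι (fun b _ hb => if_neg (fun h => hb (Fin.ext h).symm))
        (fun h => absurd (Finset.mem_univ _) h), if_pos rfl] at this
      exact hc this
    have hlt : (∑ ι : Fin d, C (w (i, l, ι)) * X ^ (ι : ℕ) : K[X]).natDegree < (red Q).natDegree := by
      rw [hdeg]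
      refine lt_of_le_of_lt (natDegree_sum_le_of_forall_le _ _ fun ι _ =>
        (natDegree_C_mul_X_pow_le _ _).trans (Nat.le_sub_one_of_lt ι.is_lt)) ?_
      omega
    exact hp0 (eq_zero_of_dvd_of_natDegree_lt hdvd hlt)
  by_contra h
  push Not at h
  exact hne (eq_zero_of_forall_evRoot Q hm hdeg hd hsep _ fun ζ => h ζ i l)

end SmallPoly

/-! ### The theorem over an algebraically closed field -/

section AlgClosed

variable {K : Type u} [Field K] [IsAlgClosed K]

omit [IsAlgClosed K] in
/-- The `y`-degree of the coefficients of a polynomial of total degree `≤ d`. [folklore] -/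
theorem natDegree_coeff_le_of_total {Q : Polynomial K[X]} {d : ℕ} (htot : ∀ i j, d < i + j → (Q.coeff i).coeff j = 0)
    (i : ℕ) : (Q.coeff i).natDegree ≤ d :=
  natDegree_le_iff_coeff_eq_zero.2 fun j hj => htot i j (by omega)

/-- **Kaltofen's Thm. 4, correctness of the Absolute Irreducibility Test, over `K = K̄`.**
For `Q ∈ K[y][x]` monic of degree `d ≥ 2` in `x`, of total degree `≤ d`, with
`Res_x(Q(x,0), ∂ₓQ(x,0)) ≠ 0`: all `Δ_S` vanish at the coefficients of `Q` iff `Q` is reducible.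
[cite: Kaltofen1995, §2 Lemma 2 and "proof of correctness", §3 Thm. 4] -/
theorem genMinor_correct_of_isAlgClosed (d : ℕ) (hd : 2 ≤ d) (Q : Polynomial K[X]) (hmo : Q.Monic)
    (hdeg : Q.natDegree = d) (htot : ∀ i j, d < i + j → (Q.coeff i).coeff j = 0) (hres : rres Q d ≠ 0) :
    (∀ S : Fin d × Fin (d + 1) × Fin d → Fin ((2 * d - 1) * d + 1) × Fin d,
        specialize (coeffVec Q) (genMinor d S) = 0) ↔ ¬ Irreducible Q := by
  classical
  have hd0 : d ≠ 0 := by omega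
  have hm : (red Q).Monic := hmo.map _
  have hdeg0 : (red Q).natDegree = d := by rw [red, hmo.natDegree_map, hdeg]
  have hsep : (red Q).Separable := separable_red Q hdeg0 hd0 hres
  have hcoef : ∀ i, (Q.coeff i).natDegree ≤ d := natDegree_coeff_le_of_total htot
  set ℓ := (2 * d - 1) * d with hℓ
  set K' := 2 * ℓ + 1 with hK'
  -- Step 1: the forms are the maximal minors of `M(Q)`; minors ↔ kernel ↔ annihilators
  simp_rw [specialize_genMinor Q hmo hdeg htot hm]
  rw [forall_det_submatrix_eq_zero_iff]
  simp_rw [kMatrix_mulVec_eq_zero_iff hm hdeg0 hres]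
  -- the approximate root and its branches
  have hroot : (X : (Rt Q)[X]) ^ (K' + 1) ∣ (liftR Q).eval (alphaTrue Q d d K') :=
    X_pow_dvd_eval_alphaTrue hres hd0 hdeg.le hcoef
  have hbranch : ∀ ζ : (red Q).rootSet K,
      (X : K[X]) ^ (K' + 1) ∣ Q.eval ((alphaTrue Q d d K').map (evRoot Q ζ)) := by
    intro ζ
    have := map_dvd (mapRingHom (evRoot Q ζ)) hroot
    rwa [map_pow, coe_mapRingHom, map_X, map_eval_eq, liftR_map_evRoot] at this
  constructor
  · -- (⇒) a nonzero small annihilator forces reducibility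
    rintro ⟨w, hw, hdvd⟩ hirr
    obtain ⟨ζ, i, l, hζ⟩ := exists_evRoot_coeff_ne_zero Q d d hm hdeg0 hd0 hsep w hw
    set hζ' := (smallPoly Q d d w).map (mapRingHom (evRoot Q ζ)) with hhζ'
    have hne : hζ' ≠ 0 := by
      intro h0
      apply hζ
      have := congrArg (fun P : Polynomial K[X] => (P.coeff i).coeff l) h0
      simpa only [hhζ', coeff_map, coe_mapRingHom, coeff_zero] using this
    refine hne (eq_zero_of_pow_dvd_eval (A := K) (δ := d) (d := d) (κ := ℓ + 1) (by omega) hdeg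
      (by rw [hmo.leadingCoeff]; exact isUnit_one) hirr hcoef ?_ ?_ (by rw [hℓ]; omega)
      ((pow_dvd_pow X (by omega)).trans (hbranch ζ)) ?_)
    · exact (natDegree_map_le).trans (natDegree_smallPoly_le Q d d w)
    · intro n
      rw [hhζ', coeff_map, coe_mapRingHom]
      exact (natDegree_map_le).trans (natDegree_coeff_smallPoly_le Q d d w n)
    · have := map_dvd (mapRingHom (evRoot Q ζ)) hdvd
      rwa [map_pow, coe_mapRingHom, map_X, map_eval_eq] at this
  · -- (⇐) reducible ⇒ a nonzero small annihilator at one root, spread by a Lagrange idempotent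
    intro hQ
    have hne : Nonempty ((red Q).rootSet K) := by
      rw [← Fintype.card_pos_iff, card_rootSet_red Q hdeg0 hsep]; omega
    obtain ⟨ζ₁⟩ := hne
    -- a small annihilator `P` of the branch at `ζ₁`
    have hP : ∃ P : Polynomial K[X], P.natDegree ≤ d - 1 ∧ (∀ n, (P.coeff n).natDegree ≤ d - 1) ∧
        (X : K[X]) ^ (ℓ + 1) ∣ P.eval ((alphaTrue Q d d K').map (evRoot Q ζ₁)) ∧ P ≠ 0 := by
      by_contra hcon
      push Not at hcon
      refine hQ (irreducible_of_noSmallAnnihilator (κ := ℓ + 1) (a₀ := (alphaTrue Q d d K').map (evRoot Q ζ₁))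
        (by omega) hdeg one_ne_zero (by rw [hmo.leadingCoeff, C_1]) (fun n m h => htot n m (by omega)) ?_
        fun P h1 h2 h3 => ?_)
      · rw [show 2 * (ℓ + 1) = K' + 1 by omega]; exact hbranch ζ₁
      · exact hcon P h1 h2 h3
    obtain ⟨P, hP1, hP2, hP3, hP0⟩ := hP
    obtain ⟨L, hLdeg, hL0, hL1, hL⟩ := exists_idempotent Q ζ₁
    rw [card_rootSet_red Q hdeg0 hsep] at hLdeg
    -- the unknowns: `w_{i,l,ι} = p_{i,l} · L_ι`
    let w : Fin d × Fin (d + 1) × Fin d → K := fun c => (P.coeff c.1).coeff c.2.1 * L.coeff c.2.2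
    have hsmall : smallPoly Q d d w = C (C (AdjoinRoot.mk (red Q) L)) *
        P.map (mapRingHom (algebraMap K (Rt Q))) := by
      ext i j
      rw [coeff_C_mul, coeff_C_mul, coeff_map, coe_mapRingHom, coeff_map]
      by_cases hi : i < d
      · by_cases hj : j < d + 1
        · have := coeff_coeff_smallPoly Q d d w ⟨i, hi⟩ ⟨j, hj⟩
          rw [this]
          change AdjoinRoot.mk (red Q) (∑ ι : Fin d, C ((P.coeff i).coeff j * L.coeff ι) * X ^ (ι : ℕ)) = _
          rw [AdjoinRoot.algebraMap_eq, ← AdjoinRoot.mk_C, ← map_mul]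
          congr 1
          have hLsum : L = ∑ ι : Fin d, C (L.coeff ι) * X ^ (ι : ℕ) := by
            conv_lhs => rw [L.as_sum_range' d hLdeg]
            rw [Fin.sum_univ_eq_sum_range (fun ι => C (L.coeff ι) * X ^ ι) d]
            simp_rw [← C_mul_X_pow_eq_monomial]
          conv_rhs => rw [hLsum]
          simp only [Finset.sum_mul, C_mul]
          exact Finset.sum_congr rfl fun ι _ => by ring
        · have h1 : ((smallPoly Q d d w).coeff i).coeff j = 0 :=
            coeff_eq_zero_of_natDegree_lt ((natDegree_coeff_smallPoly_le Q d d w i).trans_lt (by omega))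
          have h2 : (P.coeff i).coeff j = 0 :=
            coeff_eq_zero_of_natDegree_lt ((hP2 i).trans_lt (by omega))
          rw [h1, h2, map_zero, mul_zero]
      · have h1 : (smallPoly Q d d w).coeff i = 0 :=
          coeff_eq_zero_of_natDegree_lt ((natDegree_smallPoly_le Q d d w).trans_lt (by omega))
        have h2 : P.coeff i = 0 := coeff_eq_zero_of_natDegree_lt (hP1.trans_lt (by omega))
        rw [h1, h2, coeff_zero, coeff_zero, map_zero, mul_zero]
    refine ⟨w, ?_, ?_⟩
    · -- `w ≠ 0`
      obtain ⟨i, hi⟩ : ∃ i, P.coeff i ≠ 0 := by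
        by_contra h; push Not at h; exact hP0 (Polynomial.ext fun i => by rw [h i, coeff_zero])
      obtain ⟨j, hj⟩ : ∃ j, (P.coeff i).coeff j ≠ 0 := by
        by_contra h; push Not at h; exact hi (Polynomial.ext fun j => by rw [h j, coeff_zero])
      obtain ⟨ι, hι⟩ : ∃ ι, L.coeff ι ≠ 0 := by
        by_contra h; push Not at h; exact hL0 (Polynomial.ext fun ι => by rw [h ι, coeff_zero])
      have hid : i < d := by
        by_contra h
        exact hi (coeff_eq_zero_of_natDegree_lt (hP1.trans_lt (by omega)))
      have hjd : j < d + 1 := by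
        by_contra h
        exact hj (coeff_eq_zero_of_natDegree_lt ((hP2 i).trans_lt (by omega)))
      have hιd : ι < d := by
        by_contra h
        exact hι (coeff_eq_zero_of_natDegree_lt (hLdeg.trans_le (by omega)))
      intro hw0
      have := congr_fun hw0 (⟨i, hid⟩, ⟨j, hjd⟩, ⟨ι, hιd⟩)
      exact mul_ne_zero hj hι this
    · -- `y^{ℓ+1} ∣ h_w(α)`: check at every root
      refine X_pow_dvd_of_forall_evRoot Q hm hdeg0 hd0 hsep _ _ fun ζ => ?_
      rw [map_eval_eq, hsmall, Polynomial.map_mul, map_C, coe_mapRingHom, map_C, Polynomial.map_map, mapRingHom_comp,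
        evRoot_comp_algebraMap, mapRingHom_id, Polynomial.map_id]
      by_cases hζ : ζ = ζ₁
      · subst hζ
        rw [hL1, C_1, C_1, one_mul]
        exact hP3
      · rw [hL ζ hζ, C_0, C_0, zero_mul, eval_zero]
        exact dvd_zero _

end AlgClosed

/-! ### The theorem over an arbitrary field -/

section AnyField

variable {F : Type u} [Field F]

/-- The coefficient vector commutes with base change. [folklore] -/
theorem specialize_coeffVec_mapP {L : Type*} [CommRing L] (φ : F →+* L) (ψ : Polynomial F[X]) (G : GenCoeff) :
    specialize (coeffVec (mapP φ ψ)) G = φ (specialize (coeffVec ψ) G) := by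
  have hq : coeffVec (mapP φ ψ) = φ ∘ coeffVec ψ := by
    funext p; simp only [coeffVec, mapP, coeff_map, coe_mapRingHom, Function.comp_apply]
  rw [specialize, specialize, MvPolynomial.coe_eval₂Hom, MvPolynomial.coe_eval₂Hom, MvPolynomial.eval₂_comp_left, hq,
    RingHom.eq_intCast' (φ.comp (Int.castRingHom F))]

/-- **Kaltofen's Thm. 4, correctness of the Absolute Irreducibility Test.** For a field `F` and
`ψ ∈ F[y][x]` monic of degree `d ≥ 2` in `x`, of total degree `≤ d`, with
`Res_x(ψ(x,0), ∂ₓψ(x,0)) ≠ 0`: all the integer forms `Δ_S = genMinor d S` vanish at the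
coefficients of `ψ` (read in `F`) iff `ψ` is reducible over the algebraic closure of `F`.
[cite: Kaltofen1995, §3 Thm. 4] -/
theorem genMinor_correct (d : ℕ) (hd : 2 ≤ d) (ψ : Polynomial F[X]) (hmo : ψ.Monic) (hdeg : ψ.natDegree = d)
    (htot : ∀ i j, d < i + j → (ψ.coeff i).coeff j = 0) (hres : rres ψ d ≠ 0) :
    (∀ S : Fin d × Fin (d + 1) × Fin d → Fin ((2 * d - 1) * d + 1) × Fin d,
        specialize (coeffVec ψ) (genMinor d S) = 0) ↔
      ¬ Irreducible (mapP (algebraMap F (AlgebraicClosure F)) ψ) := by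
  set φ := algebraMap F (AlgebraicClosure F) with hφ
  have hQmo : (mapP φ ψ).Monic := hmo.map _
  have hQdeg : (mapP φ ψ).natDegree = d := by rw [mapP, hmo.natDegree_map, hdeg]
  have hQtot : ∀ i j, d < i + j → ((mapP φ ψ).coeff i).coeff j = 0 := by
    intro i j h
    rw [mapP, coeff_map, coe_mapRingHom, coeff_map, htot i j h, map_zero]
  have hQres : rres (mapP φ ψ) d ≠ 0 := by rw [rres_mapP]; exact (map_ne_zero φ).2 hres
  rw [← genMinor_correct_of_isAlgClosed d hd (mapP φ ψ) hQmo hQdeg hQtot hQres]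
  refine forall_congr' fun S => ?_
  rw [specialize_coeffVec_mapP, map_eq_zero φ]

end AnyField

end Literature.RingTheory.MvPolynomial.KaltofenFormsCorrect

end
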